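import Summits.QuantumFields.YangMills.Theorems.AllWindowsColdBoxBoxHighLineFPOperatorFloor
import Summits.QuantumFields.YangMills.Theorems.AllWindowsColdBoxBoxHighLineDirichletGreenHilbertSchmidt

/-!
# TASK T-S5/U5.4i «Haar–Gaussian merge»: `DirichletGreenFrobeniusRow` (4i-a) and `DetOnePlusPSDBounds` (4i-b), typed verbatim from the
# planner's text and PROVED

Planner ym-idea-2 g17, bus `ym-idea-2/INBOX.md` 2026-08-29T17:15:44Z (T-S5.4 bricks, 4i), for the XL comparison stubs S5 (LINE-19
⟨stmt-QuantumFields-24004⟩/⟨24335⟩) and U5 (LINE-20 ⟨24336⟩).  Purpose (STEP1b §3): the Haar factor `exp(−Σ_x |A_x|²/3)` of T-S5.4d merges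
into the Gaussian, `∫exp(−β‖Mv‖² − ‖v‖²/3)dv / ∫exp(−β‖Mv‖²)dv = det(1 + (3β)⁻¹(MᵀM)⁻¹)^{−1/2}`, and this determinant is `1 + O(tr((MᵀM)⁻¹)/β)`:

* (4i-a) **`DirichletGreenFrobeniusRow`** (typed here; PROOF BY NAME TO BE APPENDED): `Σ_t G(s,t)² ≤ C·(1 + log H)⁴` for the interior
  Dirichlet Green's function `G = (boxLap (2H) univ)⁻¹`.  Its content is the LEAD's ✓`DirichletGreenHilbertSchmidt.dirichletGreenRowSqSum` (seat
  sfw-p2 g77, ✓p735097: the geometric-mean trick of ✓4f-i squared, factorised into four harmonic sums; our TAKINGs crossed — bus 17:22:55Z), so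
  it is CITED, not re-proved: the one-liner `theorem dirichletGreenFrobeniusRow : DirichletGreenFrobeniusRow := ⟨C, h⟩` over that lemma is
  appended to this file (append-only protocol) as soon as the farm serves that module's olean.
* (4i-b) **`DetOnePlusPSDBounds`**: `1 ≤ det(1 + S) ≤ exp(tr S)` for a positive semidefinite real `S` — spectral theorem
  (`Matrix.IsHermitian.spectral_theorem`: `S = U·diag(λ)·U⋆`), so `1 + S = U·diag(1 + λ)·U⋆`, `det(1 + S) = ∏ᵢ (1 + λᵢ)` with `λᵢ ≥ 0`
  (`Matrix.PosSemidef.eigenvalues_nonneg`), `tr S = Σᵢ λᵢ` (`trace_eq_sum_eigenvalues`), and `1 ≤ 1 + λᵢ ≤ exp λᵢ` (`Real.add_one_le_exp`).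

Mathlib + tree only; the only definitions are the two task Props (verbatim); standard axioms.  HONEST LABEL: elementary bricks of step (1b) of
the XL stubs S5/U5; T-S5.4 proper, S5, U5 and the cruxes ⟨24004⟩ ⟨24335⟩ ⟨24336⟩ remain OPEN; no summit is proved; the Yang–Mills mass gap is NOT
proved by this file.  Seat ym-line-sfw-p2-w5 g21 (cell ym-idea-1).
-/

set_option autoImplicit false

noncomputable section

open Matrix Finset
open Summit.QuantumFields.YangMills.Theorems.AllWindowsColdBox.BoxKernel (Box boxLap boxLap_inv_size_decay)

namespace Summit.QuantumFields.YangMills.Theorems.AllWindowsColdBoxBoxHighLine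

/-! ## The task's Props (verbatim from the planner's text) -/

/-- T-S5.4i-a **(Frobenius row sums of the interior Dirichlet Green's function; S–M)**: `Σ_t G(s,t)² ≤ C·(1 + log H)⁴`. -/
def DirichletGreenFrobeniusRow : Prop :=
  ∃ C : ℝ, ∀ H : ℕ, 1 ≤ H → ∀ s : Box 4 (2*H) Finset.univ,
    ∑ t, ((boxLap (2*H) (Finset.univ : Finset (Fin 4)))⁻¹ s t) ^ 2 ≤ C * (1 + Real.log H) ^ 4

/-- T-S5.4i-b **(determinant of `1 +` a positive semidefinite matrix; S)**: `1 ≤ det(1 + S) ≤ exp(tr S)`. -/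
def DetOnePlusPSDBounds : Prop :=
  ∀ (n : ℕ) (S : Matrix (Fin n) (Fin n) ℝ), S.PosSemidef → 1 ≤ (1 + S).det ∧ (1 + S).det ≤ Real.exp S.trace

/-! ## T-S5.4i-a: see the module docstring — the by-name proof over ✓`DirichletGreenHilbertSchmidt.dirichletGreenRowSqSum` is appended
once that module's olean is served (it cannot be imported before). -/

/-! ## T-S5.4i-b -/

/-- **T-S5.4i-b: `1 ≤ det(1 + S) ≤ exp(tr S)` for positive semidefinite `S`.** -/
theorem detOnePlusPSDBounds : DetOnePlusPSDBounds := by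
  intro n S hS
  set U := hS.1.eigenvectorUnitary with hU
  set ev : Fin n → ℝ := hS.1.eigenvalues with hev
  have hev0 : ∀ i, 0 ≤ ev i := fun i => hS.eigenvalues_nonneg i
  -- `1 + S = U (diag (1 + ev)) U⋆`
  have hdiag : diagonal (RCLike.ofReal ∘ hS.1.eigenvalues : Fin n → ℝ) = diagonal ev := by
    congr 1
  have h1S : 1 + S = Unitary.conjStarAlgAut ℝ (Matrix (Fin n) (Fin n) ℝ) U (diagonal fun i => 1 + ev i) := by
    have h1d : (diagonal fun i => 1 + ev i) = 1 + diagonal ev := by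
      rw [← diagonal_one, diagonal_add]
    rw [h1d, map_add, map_one, ← hdiag, hU, ← hS.1.spectral_theorem]
  have hUU : (U : Matrix (Fin n) (Fin n) ℝ).det * (star (U : Matrix (Fin n) (Fin n) ℝ)).det = 1 := by
    rw [← det_mul, Unitary.mul_star_self_of_mem U.2, det_one]
  have hdet : (1 + S).det = ∏ i, (1 + ev i) := by
    rw [h1S, Unitary.conjStarAlgAut_apply, det_mul, det_mul, det_diagonal]
    calc (U : Matrix (Fin n) (Fin n) ℝ).det * (∏ i, (1 + ev i)) * (star (U : Matrix (Fin n) (Fin n) ℝ)).det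
        = (∏ i, (1 + ev i)) * ((U : Matrix (Fin n) (Fin n) ℝ).det * (star (U : Matrix (Fin n) (Fin n) ℝ)).det) := by ring
      _ = ∏ i, (1 + ev i) := by rw [hUU, mul_one]
  have htr : S.trace = ∑ i, ev i := by
    have h := hS.1.trace_eq_sum_eigenvalues
    simpa using h
  rw [hdet, htr, Real.exp_sum]
  constructor
  · calc (1 : ℝ) = ∏ _i : Fin n, (1 : ℝ) := by simp
      _ ≤ ∏ i, (1 + ev i) := Finset.prod_le_prod (fun _ _ => zero_le_one) fun i _ => by linarith [hev0 i]
  · exact Finset.prod_le_prod (fun i _ => by linarith [hev0 i]) fun i _ => by linarith [Real.add_one_le_exp (ev i)]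

/-! ## T-S5.4i-a by name (appended) -/

/-- **T-S5.4i-a: Frobenius row sums of the interior Dirichlet Green's function are `O((1 + log H)⁴)`** — by name, over the LEAD's
✓`dirichletGreenRowSqSum` of `…DirichletGreenHilbertSchmidt` (seat sfw-p2 g77, ✓p735097; content cited, not re-proved). -/
theorem dirichletGreenFrobeniusRow : DirichletGreenFrobeniusRow := by
  obtain ⟨C, _, h⟩ := dirichletGreenRowSqSum
  exact ⟨C, h⟩

end Summit.QuantumFields.YangMills.Theorems.AllWindowsColdBoxBoxHighLine

end
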